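import Literature.NumberTheory.LFunctions.MontgomeryVaughan2001PrimeSums
import Literature.Analysis.Fourier.AbsSinFourierSeries
import HarnessLib

/-!
# Montgomery–Vaughan 2001, Lemma 2 (Roy–Vatwani 2019, Lemma 7.2), I: the `|sin|`-sum and its Fourier majorant

Support file (everything PROVED, no definitions, no named facts) for the discharge of
`Literature.Barriers.RiemannHypothesis.MontgomeryVaughan2001_zeroFree`. Roy–Vatwani's proof of
Lemma 7.2 (`k = 1`, `F(s) = ζ(s)` at a horizontally displaced point) starts from
`|F(σ+it)/F(σ)| ≤ exp(∑_n (Λ(n)/(nᵠ log n)) |1 − n^{−it}|) = exp(2 ∑_n Λ(n)/(nᵠ log n) |sin(½ t log n)|)`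
and expands `|sin|` in its Fourier series `∑_m 2/(π(1−4m²)) e^{2imx}`, which turns the sum into
`(4/π) log ζ(σ) − ∑_{m ≥ 1} (8/(π(4m²−1))) log|ζ(σ+imt)|`. Here this is carried out prime by prime
(Mercator series, `PrimeLogSeries.primeZetaLog`) with the TRUNCATED majorant of
`AbsSinFourierSeries.abs_sin_le_truncated`, giving for every `M : ℕ` the master inequality
(`log_norm_zeta_shift_sub_le`)

`log|ζ(s+it)| − log|ζ(s)| ≤ (4/π + 2/(M+1)) log|ζ(σ)| − ∑_{m=1}^{M} (8/(π(4m²−1))) log|ζ(σ+imt)|`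

for `Re s = σ > 1` and real `t` (`s` itself may be off the real axis: `F(s) = ζ(s + iτ)`).
The case analysis with the bounds for `ζ` near `σ = 1` (Lemma 7.2 proper) is the sequel
`MontgomeryVaughan2001Lemma2.lean`.

## Main results (namespace `Literature.NumberTheory.LFunctions.MontgomeryVaughan2001`)
- `primes_cpow_neg_eq_exp`, `re_exp_pow`-type bookkeeping for `p^{−(σ+iy)}`.
- `norm_neg_log_shift_le_tsum` : the per-prime `|sin|`-series bound.
- `sinTerm_le_majorant` : the termwise truncated Fourier majorant.
- `norm_neg_log_shift_le` : per prime, `… ≤ (4/π+2/(M+1))(−log(1−p^{−σ})) − ∑_m w_m Re(−log(1−p^{−σ−imt}))`.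
- `norm_primeZetaLog_shift_sub_le` : summed over the primes.
- `log_norm_zeta_shift_sub_le` : the master inequality displayed above.

## References
- [RoyVatwani2019] A. Roy, A. Vatwani, *Zeros of partial sums of L-functions*, Adv. Math. 346
  (2019), proof of Lemma 7.2, displays (fof)–(ff1) (arXiv p. 16).
- [MontgomeryVaughan2001] H. L. Montgomery, R. C. Vaughan, *Mean values of multiplicative
  functions*, Period. Math. Hungar. 43 (2001), Lemma 2 (cited through Roy–Vatwani; not held).
-/

noncomputable section

open Complex Real Filter Topology Finset

namespace Literature.NumberTheory.LFunctions.MontgomeryVaughan2001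

open Nicolas

/-! ### Prime powers as exponentials -/

/-- `p^{−c} = exp(−c log p)` for a prime `p`. [folklore] -/
theorem primes_cpow_neg_eq_exp (p : Nat.Primes) (c : ℂ) :
    ((p : ℕ) : ℂ) ^ (-c) = Complex.exp (-(c * Real.log (p : ℕ))) := by
  have hp : ((p : ℕ) : ℂ) ≠ 0 := by exact_mod_cast p.2.ne_zero
  rw [Complex.cpow_def_of_ne_zero hp, ← Complex.natCast_log]
  ring_nf

/-- The `n`-th power: `(p^{−(σ+iy)})ⁿ = exp(−nσ log p) · exp(−i n y log p)`, so its real part is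
`(p^{−σ})ⁿ cos(n y log p)` . [folklore] -/
theorem re_primes_cpow_neg_pow (p : Nat.Primes) (σ y : ℝ) (n : ℕ) :
    ((((p : ℕ) : ℂ) ^ (-((σ : ℂ) + y * I))) ^ n).re =
      (((p : ℕ) : ℝ) ^ (-σ)) ^ n * Real.cos (n * y * Real.log (p : ℕ)) := by
  have hp : (0 : ℝ) < (p : ℕ) := by exact_mod_cast p.2.pos
  rw [primes_cpow_neg_eq_exp, ← Complex.exp_nat_mul, Complex.exp_re]
  have hre : ((n : ℂ) * -(((σ : ℂ) + y * I) * (Real.log (p : ℕ) : ℂ))).re =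
      n * (-σ * Real.log (p : ℕ)) := by
    simp only [Complex.mul_re, Complex.mul_im, Complex.neg_re, Complex.neg_im, Complex.add_re,
      Complex.add_im, Complex.ofReal_re, Complex.ofReal_im, Complex.natCast_re, Complex.natCast_im,
      Complex.I_re, Complex.I_im]
    ring
  have him : ((n : ℂ) * -(((σ : ℂ) + y * I) * (Real.log (p : ℕ) : ℂ))).im =
      -(n * y * Real.log (p : ℕ)) := by
    simp only [Complex.mul_re, Complex.mul_im, Complex.neg_re, Complex.neg_im, Complex.add_re,
      Complex.add_im, Complex.ofReal_re, Complex.ofReal_im, Complex.natCast_re, Complex.natCast_im,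
      Complex.I_re, Complex.I_im]
    ring
  rw [hre, him, Real.cos_neg, Real.exp_nat_mul', Real.rpow_def_of_pos hp]
  ring_nf
  where
  /-- `exp (n x) = (exp x)ⁿ` (auxiliary restatement). [folklore] -/
  Real.exp_nat_mul' (x : ℝ) (n : ℕ) : Real.exp (n * x) = Real.exp x ^ n := Real.exp_nat_mul x n

/-- `‖(p^{−(σ+iy)})ⁿ‖ = (p^{−σ})ⁿ`. [folklore] -/
theorem norm_primes_cpow_neg_pow (p : Nat.Primes) (σ y : ℝ) (n : ℕ) :
    ‖(((p : ℕ) : ℂ) ^ (-((σ : ℂ) + y * I))) ^ n‖ = (((p : ℕ) : ℝ) ^ (-σ)) ^ n := by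
  rw [norm_pow, norm_primes_cpow_neg]
  simp

/-- Horizontal displacement multiplies `p^{−s}` by the unimodular `p^{−it} = exp(iu)`, `u = −t log p`:
`p^{−(s+it)} = p^{−s} · exp(i u)`. [folklore] -/
theorem primes_cpow_neg_add_mul_I (p : Nat.Primes) (s : ℂ) (t : ℝ) :
    ((p : ℕ) : ℂ) ^ (-(s + t * I)) =
      ((p : ℕ) : ℂ) ^ (-s) * Complex.exp (((-(t * Real.log (p : ℕ)) : ℝ) : ℂ) * I) := by
  rw [primes_cpow_neg_eq_exp, primes_cpow_neg_eq_exp, ← Complex.exp_add]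
  push_cast
  ring_nf

/-- `‖zⁿ − (z e^{iu})ⁿ‖ = ‖z‖ⁿ · 2|sin(nu/2)|`. [folklore] -/
theorem norm_pow_sub_pow_mul_exp (z : ℂ) (u : ℝ) (n : ℕ) :
    ‖z ^ n - (z * Complex.exp ((u : ℂ) * I)) ^ n‖ = ‖z‖ ^ n * (2 * |Real.sin (n * u / 2)|) := by
  rw [mul_pow, ← mul_one_sub, norm_mul, norm_pow, ← Complex.exp_nat_mul, norm_sub_rev]
  have h := Complex.norm_exp_I_mul_ofReal_sub_one (n * u)
  rw [show I * (((n : ℝ) * u : ℝ) : ℂ) = (n : ℂ) * ((u : ℂ) * I) by push_cast; ring] at h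
  rw [h, Real.norm_eq_abs, abs_mul, abs_of_pos (by norm_num : (0:ℝ) < 2)]

/-! ### The per-prime `|sin|` series -/

/-- For `Re s = σ > 0`, a prime `p` and real `t`:
`‖(−log(1 − p^{−s})) − (−log(1 − p^{−(s+it)}))‖ ≤ ∑_n (p^{−σ})ⁿ · 2|sin(n t log p / 2)| / n`
(Roy–Vatwani (fof): "`|F(σ+it)/F(σ)| ≤ exp(k ∑ Λ(n)/(nᵠ log n) |sin(½ t log n)|)`", prime by prime).
[cite: RoyVatwani2019, proof of Lemma 7.2] -/
theorem norm_neg_log_shift_le_tsum (p : Nat.Primes) {s : ℂ} (hs : 0 < s.re) (t : ℝ) :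
    ‖(-Complex.log (1 - ((p : ℕ) : ℂ) ^ (-s))) - (-Complex.log (1 - ((p : ℕ) : ℂ) ^ (-(s + t * I))))‖
      ≤ ∑' n : ℕ, (((p : ℕ) : ℝ) ^ (-s.re)) ^ n * (2 * |Real.sin (n * (t * Real.log (p : ℕ)) / 2)|) / n := by
  set z : ℂ := ((p : ℕ) : ℂ) ^ (-s) with hz
  have hz1 : ‖z‖ < 1 := norm_primes_cpow_neg_lt_one p hs
  have hzn : ‖z‖ = ((p : ℕ) : ℝ) ^ (-s.re) := norm_primes_cpow_neg p s
  have hshift : ((p : ℕ) : ℂ) ^ (-(s + t * I)) =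
      z * Complex.exp (((-(t * Real.log (p : ℕ)) : ℝ) : ℂ) * I) := by
    rw [hz, primes_cpow_neg_add_mul_I]
  have hz2 : ‖z * Complex.exp (((-(t * Real.log (p : ℕ)) : ℝ) : ℂ) * I)‖ < 1 := by
    rwa [norm_mul, Complex.norm_exp_ofReal_mul_I, mul_one]
  rw [hshift]
  refine (norm_neg_log_sub_neg_log_le hz1 hz2).trans (le_of_eq (tsum_congr fun n => ?_))
  rw [norm_pow_sub_pow_mul_exp, hzn, show (n : ℝ) * -(t * Real.log (p : ℕ)) / 2 =
    -(n * (t * Real.log (p : ℕ)) / 2) by ring, Real.sin_neg, abs_neg]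

/-- The termwise truncated Fourier majorant: for `0 ≤ a`, `n`, `M : ℕ` and real `φ`,
`aⁿ · 2|sin(nφ/2)| / n ≤ (4/π + 2/(M+1)) aⁿ/n − ∑_{m<M} (8/(π(4(m+1)²−1))) aⁿ cos(n (m+1) φ)/n`
(`AbsSinFourierSeries.abs_sin_le_truncated` multiplied by `aⁿ/n ≥ 0`; both sides vanish at `n = 0`).
[cite: RoyVatwani2019, proof of Lemma 7.2] -/
theorem sinTerm_le_majorant {a : ℝ} (ha : 0 ≤ a) (φ : ℝ) (M n : ℕ) :
    a ^ n * (2 * |Real.sin (n * φ / 2)|) / n ≤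
      (4 / π + 2 / ((M : ℝ) + 1)) * (a ^ n / n) -
        ∑ m ∈ Finset.range M, 8 / (π * (4 * ((m : ℝ) + 1) ^ 2 - 1)) *
          (a ^ n * Real.cos (n * (((m : ℝ) + 1) * φ)) / n) := by
  rcases Nat.eq_zero_or_pos n with rfl | hn
  · simp
  have h := Literature.Analysis.Fourier.abs_sin_le_truncated M (n * φ / 2)
  have hw : 0 ≤ a ^ n / n := by positivity
  -- rewrite the cosines: `2 (m+1) (nφ/2) = n ((m+1) φ)`
  have hcos : ∀ m : ℕ, Real.cos (2 * ((m : ℝ) + 1) * (n * φ / 2)) = Real.cos (n * (((m : ℝ) + 1) * φ)) := by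
    intro m; congr 1; ring
  simp_rw [hcos] at h
  set S : ℝ := ∑ m ∈ Finset.range M, 4 / (π * (4 * ((m : ℝ) + 1) ^ 2 - 1)) *
    Real.cos (n * (((m : ℝ) + 1) * φ)) with hS
  have h2 := mul_le_mul_of_nonneg_right h hw
  have hsum : (∑ m ∈ Finset.range M, 8 / (π * (4 * ((m : ℝ) + 1) ^ 2 - 1)) *
      (a ^ n * Real.cos (n * (((m : ℝ) + 1) * φ)) / n)) = 2 * S * (a ^ n / n) := by
    rw [hS, Finset.mul_sum, Finset.sum_mul]
    refine Finset.sum_congr rfl fun m _ => ?_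
    ring
  rw [hsum]
  calc a ^ n * (2 * |Real.sin (n * φ / 2)|) / n = 2 * (|Real.sin (n * φ / 2)| * (a ^ n / n)) := by ring
    _ ≤ 2 * ((2 / π - S + 1 / ((M : ℝ) + 1)) * (a ^ n / n)) := mul_le_mul_of_nonneg_left h2 (by norm_num)
    _ = (4 / π + 2 / ((M : ℝ) + 1)) * (a ^ n / n) - 2 * S * (a ^ n / n) := by ring

/-- Summing the majorant over `n`: for `0 ≤ a < 1` and the complex points `z_m` with `‖z_m‖ = a`
packaged through `hre : Re (z_mⁿ) = aⁿ cos(n (m+1) φ)`, the series of the right-hand sides has sum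
`(4/π + 2/(M+1)) (−log(1−a)) − ∑_{m<M} w_m Re(−log(1 − z_m))`. Stated for the prime-power case
directly. [cite: RoyVatwani2019, proof of Lemma 7.2] -/
theorem hasSum_majorant (p : Nat.Primes) {σ : ℝ} (hσ : 0 < σ) (t : ℝ) (M : ℕ) :
    HasSum (fun n : ℕ => (4 / π + 2 / ((M : ℝ) + 1)) * ((((p : ℕ) : ℝ) ^ (-σ)) ^ n / n) -
        ∑ m ∈ Finset.range M, 8 / (π * (4 * ((m : ℝ) + 1) ^ 2 - 1)) *
          ((((p : ℕ) : ℝ) ^ (-σ)) ^ n * Real.cos (n * (((m : ℝ) + 1) * (t * Real.log (p : ℕ)))) / n))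
      ((4 / π + 2 / ((M : ℝ) + 1)) * (-Real.log (1 - ((p : ℕ) : ℝ) ^ (-σ))) -
        ∑ m ∈ Finset.range M, 8 / (π * (4 * ((m : ℝ) + 1) ^ 2 - 1)) *
          (-Complex.log (1 - ((p : ℕ) : ℂ) ^ (-((σ : ℂ) + (((m : ℝ) + 1) * t : ℝ) * I)))).re) := by
  set a : ℝ := ((p : ℕ) : ℝ) ^ (-σ) with ha
  have ha0 : 0 ≤ a := Real.rpow_nonneg (Nat.cast_nonneg _) _
  have ha1 : a < 1 := Real.rpow_lt_one_of_one_lt_of_neg (by exact_mod_cast p.2.one_lt) (by linarith)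
  -- the real Mercator series `∑ aⁿ/n = -log(1-a)` (index shifted so that the `n = 0` term is `0`)
  have H0 : HasSum (fun n : ℕ => a ^ n / n) (-Real.log (1 - a)) := by
    have h := Real.hasSum_pow_div_log_of_abs_lt_one (x := a) (by rwa [abs_of_nonneg ha0])
    rw [← hasSum_nat_add_iff' 1]
    simpa using h
  -- the complex Mercator series at `z_m = p^{-(σ + i(m+1)t)}`, real parts
  have Hm : ∀ m : ℕ, HasSum (fun n : ℕ =>
      a ^ n * Real.cos (n * (((m : ℝ) + 1) * (t * Real.log (p : ℕ)))) / n)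
      (-Complex.log (1 - ((p : ℕ) : ℂ) ^ (-((σ : ℂ) + (((m : ℝ) + 1) * t : ℝ) * I)))).re := by
    intro m
    set zm : ℂ := ((p : ℕ) : ℂ) ^ (-((σ : ℂ) + (((m : ℝ) + 1) * t : ℝ) * I)) with hzm
    have hzm1 : ‖zm‖ < 1 := by
      refine norm_primes_cpow_neg_lt_one p ?_
      simp; exact hσ
    have h := Complex.hasSum_re (Complex.hasSum_taylorSeries_neg_log hzm1)
    refine h.congr_fun fun n => ?_
    rw [Complex.div_natCast_re, hzm, re_primes_cpow_neg_pow, ← ha]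
    ring_nf
  exact (H0.mul_left _).sub (hasSum_sum fun m _ => (Hm m).mul_left _)

/-- **Per-prime bound** (Roy–Vatwani (fof)–(ff1), prime by prime): for `Re s = σ > 0`, real `t`,
`M : ℕ`,
`‖log(1−p^{−s}) − log(1−p^{−(s+it)})‖ ≤ (4/π + 2/(M+1))(−log(1−p^{−σ})) − ∑_{m<M} w_m Re(−log(1−p^{−σ−i(m+1)t}))`,
`w_m = 8/(π(4(m+1)²−1))`. [cite: RoyVatwani2019, proof of Lemma 7.2] -/
theorem norm_neg_log_shift_le (p : Nat.Primes) {s : ℂ} (hs : 0 < s.re) (t : ℝ) (M : ℕ) :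
    ‖(-Complex.log (1 - ((p : ℕ) : ℂ) ^ (-s))) - (-Complex.log (1 - ((p : ℕ) : ℂ) ^ (-(s + t * I))))‖
      ≤ (4 / π + 2 / ((M : ℝ) + 1)) * (-Real.log (1 - ((p : ℕ) : ℝ) ^ (-s.re))) -
        ∑ m ∈ Finset.range M, 8 / (π * (4 * ((m : ℝ) + 1) ^ 2 - 1)) *
          (-Complex.log (1 - ((p : ℕ) : ℂ) ^ (-((s.re : ℂ) + (((m : ℝ) + 1) * t : ℝ) * I)))).re := by
  have H := hasSum_majorant p hs t M
  refine (norm_neg_log_shift_le_tsum p hs t).trans ?_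
  rw [← H.tsum_eq]
  have ha0 : 0 ≤ ((p : ℕ) : ℝ) ^ (-s.re) := Real.rpow_nonneg (Nat.cast_nonneg _) _
  refine Summable.tsum_le_tsum (fun n => ?_) ?_ H.summable
  · have h := sinTerm_le_majorant ha0 (t * Real.log (p : ℕ)) M n
    convert h using 3
  · -- summability of the left-hand side: dominated by `2 aⁿ`
    have ha1 : ((p : ℕ) : ℝ) ^ (-s.re) < 1 :=
      Real.rpow_lt_one_of_one_lt_of_neg (by exact_mod_cast p.2.one_lt) (by linarith)
    refine Summable.of_nonneg_of_le (fun n => by positivity) (fun n => ?_)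
      ((summable_geometric_of_lt_one ha0 ha1).mul_left 2)
    rcases Nat.eq_zero_or_pos n with rfl | hn
    · simp
    · rw [div_le_iff₀ (by exact_mod_cast hn)]
      have h1 : |Real.sin (n * (t * Real.log (p : ℕ)) / 2)| ≤ 1 := Real.abs_sin_le_one _
      have h2 : (1 : ℝ) ≤ n := by exact_mod_cast hn
      have h3 : 0 ≤ (((p : ℕ) : ℝ) ^ (-s.re)) ^ n := pow_nonneg ha0 n
      nlinarith [mul_nonneg h3 (abs_nonneg (Real.sin (n * (t * Real.log (p : ℕ)) / 2)))]

/-! ### Summing over the primes -/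

/-- Real parts of `primeZetaLog`: `Re primeZetaLog c = ∑_p Re(−log(1 − p^{−c}))` as a `HasSum`
(`Re c > 1`). [folklore] -/
theorem hasSum_re_primeZetaLog {c : ℂ} (hc : 1 < c.re) :
    HasSum (fun p : Nat.Primes => (-Complex.log (1 - ((p : ℕ) : ℂ) ^ (-c))).re) (primeZetaLog c).re := by
  have h := (summable_primeZetaLog hc).hasSum
  exact Complex.hasSum_re h

/-- On the real axis: `Re primeZetaLog σ = ∑_p −log(1 − p^{−σ})` (real logarithms), `σ > 1`. [folklore] -/
theorem hasSum_re_primeZetaLog_ofReal {σ : ℝ} (hσ : 1 < σ) :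
    HasSum (fun p : Nat.Primes => -Real.log (1 - ((p : ℕ) : ℝ) ^ (-σ))) (primeZetaLog (σ : ℂ)).re := by
  have h := hasSum_re_primeZetaLog (c := (σ : ℂ)) (by simpa using hσ)
  refine h.congr_fun fun p => ?_
  have hp : (0 : ℝ) < 1 - ((p : ℕ) : ℝ) ^ (-σ) := by
    have h1 : ((p : ℕ) : ℝ) ^ (-σ) < 1 :=
      Real.rpow_lt_one_of_one_lt_of_neg (by exact_mod_cast p.2.one_lt) (by linarith)
    linarith
  rw [primes_cpow_neg_ofReal, ← Complex.ofReal_one, ← Complex.ofReal_sub, ← Complex.ofReal_log hp.le,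
    ← Complex.ofReal_neg, Complex.ofReal_re]

/-- **The `|sin|`-sum bound, summed over the primes** (Roy–Vatwani (ff1) with the truncated
Fourier series): for `Re s = σ > 1`, real `t`, `M : ℕ`,
`‖primeZetaLog s − primeZetaLog (s + it)‖ ≤ (4/π + 2/(M+1)) Re P(σ) − ∑_{m<M} w_m Re P(σ + i(m+1)t)`.
[cite: RoyVatwani2019, proof of Lemma 7.2] -/
theorem norm_primeZetaLog_shift_sub_le {s : ℂ} (hs : 1 < s.re) (t : ℝ) (M : ℕ) :
    ‖primeZetaLog s - primeZetaLog (s + t * I)‖ ≤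
      (4 / π + 2 / ((M : ℝ) + 1)) * (primeZetaLog (s.re : ℂ)).re -
        ∑ m ∈ Finset.range M, 8 / (π * (4 * ((m : ℝ) + 1) ^ 2 - 1)) *
          (primeZetaLog ((s.re : ℂ) + (((m : ℝ) + 1) * t : ℝ) * I)).re := by
  have hs' : 1 < (s + t * I).re := by simpa using hs
  have hsum1 := summable_primeZetaLog hs
  have hsum2 := summable_primeZetaLog hs'
  have hdiff : primeZetaLog s - primeZetaLog (s + t * I) = ∑' p : Nat.Primes,
      ((-Complex.log (1 - ((p : ℕ) : ℂ) ^ (-s))) -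
        (-Complex.log (1 - ((p : ℕ) : ℂ) ^ (-(s + t * I))))) := by
    rw [primeZetaLog, primeZetaLog, ← hsum1.tsum_sub hsum2]
  -- the right-hand side as a sum over primes
  have HR : HasSum (fun p : Nat.Primes =>
      (4 / π + 2 / ((M : ℝ) + 1)) * (-Real.log (1 - ((p : ℕ) : ℝ) ^ (-s.re))) -
        ∑ m ∈ Finset.range M, 8 / (π * (4 * ((m : ℝ) + 1) ^ 2 - 1)) *
          (-Complex.log (1 - ((p : ℕ) : ℂ) ^ (-((s.re : ℂ) + (((m : ℝ) + 1) * t : ℝ) * I)))).re)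
      ((4 / π + 2 / ((M : ℝ) + 1)) * (primeZetaLog (s.re : ℂ)).re -
        ∑ m ∈ Finset.range M, 8 / (π * (4 * ((m : ℝ) + 1) ^ 2 - 1)) *
          (primeZetaLog ((s.re : ℂ) + (((m : ℝ) + 1) * t : ℝ) * I)).re) := by
    refine ((hasSum_re_primeZetaLog_ofReal hs).mul_left _).sub (hasSum_sum fun m _ => ?_)
    refine (hasSum_re_primeZetaLog (c := (s.re : ℂ) + (((m : ℝ) + 1) * t : ℝ) * I) ?_).mul_left _
    simpa using hs
  rw [hdiff, ← HR.tsum_eq]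
  refine (norm_tsum_le_tsum_norm (hsum1.sub hsum2).norm).trans ?_
  exact Summable.tsum_le_tsum (fun p => norm_neg_log_shift_le p (by linarith) t M)
    (hsum1.sub hsum2).norm HR.summable

/-- `Re primeZetaLog c = log ‖ζ(c)‖` for `Re c > 1`. [cite: MontgomeryVaughan2007, §1.3] -/
theorem re_primeZetaLog_eq_log_norm {c : ℂ} (hc : 1 < c.re) :
    (primeZetaLog c).re = Real.log ‖riemannZeta c‖ := by
  rw [norm_riemannZeta_eq_exp_re hc, Real.log_exp]

/-- **Master inequality for horizontal displacement** (Roy–Vatwani, proof of Lemma 7.2, displays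
(fof)–(ff1), with the Fourier series of `|sin|` truncated at `M`): for `Re s = σ > 1`, real `t` and
`M : ℕ`,
`log ‖ζ(s+it)‖ − log ‖ζ(s)‖ ≤ (4/π + 2/(M+1)) log ‖ζ(σ)‖ − ∑_{m=1}^{M} (8/(π(4m²−1))) log ‖ζ(σ + imt)‖`.
(As `M → ∞` the coefficient `4/π` is Roy–Vatwani's `ζ(σ)^{4k/π}`, `k = 1`, and the sum is their
product `∏_{m ≠ 0} ζ(σ − imt)^{4k/(π(1−4m²))}`.) [cite: RoyVatwani2019, proof of Lemma 7.2] -/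
theorem log_norm_zeta_shift_sub_le {s : ℂ} (hs : 1 < s.re) (t : ℝ) (M : ℕ) :
    Real.log ‖riemannZeta (s + t * I)‖ - Real.log ‖riemannZeta s‖ ≤
      (4 / π + 2 / ((M : ℝ) + 1)) * Real.log ‖riemannZeta (s.re : ℂ)‖ -
        ∑ m ∈ Finset.range M, 8 / (π * (4 * ((m : ℝ) + 1) ^ 2 - 1)) *
          Real.log ‖riemannZeta ((s.re : ℂ) + (((m : ℝ) + 1) * t : ℝ) * I)‖ := by
  have hs' : 1 < (s + t * I).re := by simpa using hs
  have hσ : 1 < ((s.re : ℂ)).re := by simpa using hs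
  have h := norm_primeZetaLog_shift_sub_le hs t M
  rw [re_primeZetaLog_eq_log_norm hσ] at h
  have hm : ∀ m : ℕ, (primeZetaLog ((s.re : ℂ) + (((m : ℝ) + 1) * t : ℝ) * I)).re =
      Real.log ‖riemannZeta ((s.re : ℂ) + (((m : ℝ) + 1) * t : ℝ) * I)‖ :=
    fun m => re_primeZetaLog_eq_log_norm (by simpa using hs)
  simp_rw [hm] at h
  refine le_trans ?_ h
  rw [← re_primeZetaLog_eq_log_norm hs', ← re_primeZetaLog_eq_log_norm hs, ← Complex.sub_re,
    norm_sub_rev]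
  exact Complex.re_le_norm _

end Literature.NumberTheory.LFunctions.MontgomeryVaughan2001
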